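import Mathlib.Algebra.Group.Subgroup.Pointwise
import Mathlib.GroupTheory.Commensurable
import Mathlib.GroupTheory.Index
import Literature.AnabelianGeometry.AbsoluteAnabelian.FundamentalExtension
import Literature.AnabelianGeometry.AbsoluteAnabelian.ProfiniteTerminology
import HarnessLib

/-!
# [GalSect]: decomposition groups, limits of Galois sections, cuspidal cyclotomic rigidity

S. Mochizuki, *Galois sections in absolute anabelian geometry*, Nagoya Math. J. 179 (2005)
17–45 [cite: MochizukiGalSect2005, Thm 1.3 (ii) p.6]; locators `p.N` are pages of the author's
kurims manuscript (25 pp., lit key `paper:url-1b7afe4e6889`; the journal pagination is not held).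
Cell abc-iut, layer L4, block W2-B12 = plan/L4/LC1-CHAIN.md §2 missing link M3: the EXTERNAL
anabelian inputs that [AbsTopIII] Cor. 1.10 (ii)(c), (iii)(e) and Thm. 1.11 (b) cite by number —
[GalSect] Thm. 1.3 (ii), Lem. 3.1 (i)⇔(iv), Cor. 3.2, Thm. 4.3.  (The [AbsCusp] items of M3 are
typed in the sibling file `AbsCuspFacts.lean`.)

## Setting of [GalSect] §1 (p. 4) and how it is typed

"Let `K`, `L` be local fields [§0 p. 2: finite extensions of `ℚ_p`; all local fields are
nonarchimedean]; `X_K` (respectively, `Y_L`) a hyperbolic curve over `K` (respectively, `L`) …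
`Π_{X_K} := π₁(X_K)` … fits into a natural exact sequence `1 → Δ_X → Π_{X_K} → G_K → 1`";
a closed point `x` of the compactification `X̄_K` "determines, up to conjugation by an element of
`Π_{X_K}`, a decomposition group `D_x ⊆ Π_{X_K}`"; "`I_x := D_x ∩ Δ_X` is isomorphic to `Ẑ(1)`
(respectively, `{1}`) if `x` is (respectively, is not) a cusp" (p. 6).

Typing policy θ of the cell (plan/L4/ASSIGNMENTS.md §2): the étale `π₁` is not in the tree, so
every result below is a PREDICATE on abstract group data over abc-iut-L4-t1's interface
`FundamentalExtension` (`E.arith = Π_{X_K}`, `E.gal = G_K`, `E.geom = Δ_X`, ACCEPTED + built) and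
its `CuspidalData` (`Dcusp`, `Icusp`): shape (1).  Data that the text reads off the curve and that
the interface does not yet carry — the decomposition groups of the NON-cuspidal closed points and
the predicate "algebraic closed point" of Lem. 3.1 — enter through the small parameter structure
`GalSect.PointData` below, a TODO-import shim for the fields `Point`, `decomp`, `IsNFPoint` of
t1's `AbsTopIII.CurveModel` (p405053, pending); sections `σ : G_K → Π_{X_K}` are written as
continuous homomorphisms with `aug ∘ σ = id` (t1's `FundamentalExtension.Section`, p405226,
pending — TODO-merge).  The MODEL-RELATIVE closed forms "for every hyperbolic curve over a local
field …" (shape (M): `∀ U, IsMLF (M.base U) → …` over `CurveModel`) are three-line wrappers to be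
added in the merge pass once `CurveModel` is built; the mathematical content is the predicates.
Junk data only falsify their own instance (no closed `∃` over free data).

## Index (item → page → decl)
* Thm. 1.3 (ii) p. 6 (Commensurable Terminality) → `GalSect.Thm_1_3_ii_points`,
  `GalSect.Thm_1_3_ii_cusps` (cited by [AbsTopIII] Thm. 1.11 p. 46).
* §3 p. 12–13 (the tower `Π_{X_K}[j, σ] = Im(σ)·Δ_X[j]`) → `GalSect.IsCharacteristicTower`,
  `GalSect.sectionNeighbourhood`.
* Lem. 3.1 p. 13, equivalence (i) ⇔ (iv) (Criterion for Galois Sections Associated to Rational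
  Points; cited by [AbsTopIII] Cor. 1.10 (iii)(e) p. 43) → `GalSect.Lem_3_1_i_iff_iv`; conditions
  (ii), (iii) speak of `K`-rational points of the covering CURVES `X_K[j, σ]` and are not group
  data — not typed.
* Cor. 3.2 p. 14 (Absoluteness of Decomposition Groups for Genus Zero; its special case is
  Thm. A p. 1) → `GalSect.Cor_3_2`; hypotheses "defined over a number field" and "isogenous to a
  hyperbolic curve of genus zero" are properties of the curves, carried as the Prop parameters of
  the (M)-wrapper (recorded in the docstring; they do not constrain the group data).
* Thm. 4.3 p. 17 (Rigidity of Cuspidal Geometric Decomposition Groups = "cyclotomic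
  synchronization", cited by [AbsTopIII] Cor. 1.10 (ii)(c) p. 42) → `GalSect.GaloisCyclotome`
  (the functorial Galois cyclotome `G_K ↦ μ^∧_{ℚ/ℤ}(K̄)` of p. 17, an OUTPUT structure in the
  sense of θ (1); TODO-merge with abc-iut-L4-t4's [AbsAnab] Prop. 1.2.1 (iv) outputs) and
  `GalSect.Thm_4_3`.

Deliberately NOT here: Thm. 1.2 / Thm. 2.3 (relative and absolute reconstruction of
`DLoc_K(X_K)`), Thm. 1.3 (i)(iii)(iv), §4 beyond Thm. 4.3, [AbsTopII] Cor. 2.10 and [Pop] Thm. 2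
(the other inputs of [AbsTopIII] Thm. 1.11 listed in LC1-CHAIN §2 M3 — separate texts).
HONEST FRAMING: these are refereed, undisputed results, entered as named predicates (statements
first, D-0014); nothing here bears on the disputed [IUTchIII] Cor. 3.12 beyond being upstream
vocabulary; establishment = our kernel check; typed ≠ discharged.
-/

noncomputable section

open scoped Classical Pointwise

namespace Literature.AnabelianGeometry.AbsoluteAnabelian

namespace GalSect

universe u

variable {E F : FundamentalExtension.{u}}

/-! ### The data read off the curve (TODO-import shim for `AbsTopIII.CurveModel`) -/

/-- The closed points of the affine curve `X_K` with (a representative of the conjugacy class of)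
their decomposition groups `D_x ⊆ Π_{X_K}` ([GalSect] §1 p. 5–6), and the predicate "algebraic
closed point" of Lem. 3.1 p. 13 (for `X_K = X_F ×_F K` defined over a number field `F`: the
points coming from `X_F(F')`, `F' ⊆ K` finite over `F`; = the NF-points of [AbsTopIII] Def. 1.7
(ii)).  TODO-import abc-iut-L4-t1 `AbsTopIII.CurveModel` (fields `Point`, `decomp`, `IsNFPoint`);
cusps are NOT in `Point` — they are t1's `CuspidalData`. [cite: MochizukiGalSect2005, §1 p.6] -/
structure PointData (E : FundamentalExtension.{u}) : Type (u + 1) where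
  /-- the closed points of `X_K` (non-cuspidal closed points of `X̄_K`) -/
  Point : Type u
  /-- a decomposition group `D_x ⊆ Π_{X_K}` ("up to conjugation by an element of `Π_{X_K}`") -/
  decomp : Point → Subgroup E.arith
  /-- `D_x` is closed ("a closed subgroup of `Π_{X_K}` which arises in this way", p. 6) -/
  isClosed_decomp : ∀ x, IsClosed (decomp x : Set E.arith)
  /-- "algebraic closed point" (Lem. 3.1 p. 13) -/
  IsAlgebraic : Point → Prop

/-- The set of ALL decomposition groups of closed points of `X_K` (all `Π_{X_K}`-conjugates of the
chosen representatives). [cite: MochizukiGalSect2005, §1 p.6] -/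
def PointData.decompositionGroups (P : PointData E) : Set (Subgroup E.arith) :=
  {D | ∃ (x : P.Point) (g : E.arith), D = MulAut.conj g • P.decomp x}

/-- "`D_x` … surjects onto `G_K`" — the group-theoretic form of `K`-rationality of a closed point
used in Lem. 3.1 (iv) p. 13 ("a decomposition group … that surjects onto `G_K`"); for a cusp this
is t1's `CuspidalData.IsRational`. [cite: MochizukiGalSect2005, Lem 3.1 (iv) p.13] -/
def SurjectsOntoGal (D : Subgroup E.arith) : Prop := Set.SurjOn E.aug D Set.univ

/-! ### Theorem 1.3 (ii) (Commensurable Terminality), p. 6 -/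

/-- Thm. 1.3 (ii), first sentence, as a property of the decomposition data of `X_K`: "The subgroup
`D_x` is commensurably terminal in `Π_{X_K}`" — for every closed point `x` (commensurably terminal
= `C_{Π}(D_x) = D_x`, §0 p. 2; the cell's `IsCommensurablyTerminal`).
[cite: MochizukiGalSect2005, Thm 1.3 (ii) p.6] -/
def Thm_1_3_ii_points (P : PointData E) : Prop :=
  ∀ x : P.Point, IsCommensurablyTerminal (P.decomp x)

/-- Thm. 1.3 (ii) for cusps, as a property of the cuspidal data of `X_K`: "`D_x` is commensurably
terminal in `Π_{X_K}`.  If `x` is a cusp, then `D_x = C_{Π_{X_K}}(H)` for any open subgroup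
`H ⊆ I_x`" (open in the profinite group `I_x` = closed of finite index in `I_x`).
[cite: MochizukiGalSect2005, Thm 1.3 (ii) p.6] -/
def Thm_1_3_ii_cusps (C : E.CuspidalData) : Prop :=
  (∀ x : C.Cusp, IsCommensurablyTerminal (C.Dcusp x)) ∧
    ∀ (x : C.Cusp) (H : Subgroup E.arith), H ≤ C.Icusp x → IsClosed (H : Set E.arith) →
      (H.subgroupOf (C.Icusp x)).FiniteIndex →
        Subgroup.Commensurable.commensurator H = C.Dcusp x

/-! ### §3: the tower `Π_{X_K}[j, σ]` attached to a section, p. 12–13 -/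

/-- "a sequence of characteristic open subgroups `… ⊆ Δ_X[j+1] ⊆ Δ_X[j] ⊆ … ⊆ Δ_X` [where `j`
ranges over the positive integers] of `Δ_X` such that `⋂_j Δ_X[j] = {1}`" (p. 12–13), as a
predicate on a sequence of subgroups of `Δ = E.geom` (indexed by `ℕ`; characteristic = stable
under every automorphism of the PROFINITE group `Δ`, i.e. every continuous group automorphism —
so that conjugation by `Π_{X_K}` preserves each `Δ_X[j]` and the standard tower "intersection of
all open subgroups of index `≤ j`" qualifies; open in the profinite `Δ` = closed of finite index).
[cite: MochizukiGalSect2005, §3 p.13] -/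
structure IsCharacteristicTower (E : FundamentalExtension.{u}) (Δj : ℕ → Subgroup E.geom) :
    Prop where
  /-- decreasing -/
  antitone : Antitone Δj
  /-- each `Δ_X[j]` is open in `Δ_X` -/
  isOpen : ∀ j, IsOpen (Δj j : Set E.geom)
  /-- each `Δ_X[j]` is characteristic in `Δ_X` -/
  characteristic : ∀ (j) (φ : E.geom ≃ₜ* E.geom), (Δj j).map φ.toMonoidHom = Δj j
  /-- `⋂_j Δ_X[j] = {1}` -/
  iInf_eq_bot : ⨅ j, Δj j = ⊥

/-- "`Π_{X_K}[j, σ] := Im(σ) · Δ_X[j] ⊆ Π_{X_K}`" (p. 13) for a section `σ : G_K → Π_{X_K}`: the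
subgroup generated by the image of `σ` and `Δ_X[j]` (equal to the product set, `Δ_X[j]` being
normal in `Π_{X_K}`). [cite: MochizukiGalSect2005, §3 p.13] -/
def sectionNeighbourhood (σ : E.gal →ₜ* E.arith) (Δj : ℕ → Subgroup E.geom) (j : ℕ) :
    Subgroup E.arith :=
  σ.toMonoidHom.range ⊔ (Δj j).map E.geom.subtype

/-! ### Lemma 3.1, (i) ⇔ (iv), p. 13 -/

/-- Lem. 3.1 (Criterion for Galois Sections Associated to Rational Points), the equivalence
(i) ⇔ (iv), as a property of the group data of a hyperbolic curve `X_K` over a local field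
"defined over a number field, i.e., there exists a hyperbolic curve `X_F` over a number field
`F ⊆ K` such that `X_K = X_F ×_F K`" (a hypothesis on the CURVE, carried by the (M)-wrapper):
for every characteristic tower `Δ_X[j]` and every section "`σ : G_K → Π_{X_K}` such that `Im(σ)`
is not contained in any cuspidal decomposition group of `Π_{X_K}`", "the following conditions on
`σ` are equivalent: (i) `σ` arises from a point `x ∈ X_K(K)` [i.e., «`Im(σ) = D_x`»] … (iv) For
every integer `j ≥ 1`, `Π_{X_K}[j, σ]` contains a decomposition group [i.e., relative to
`Π_{X_K}`] of an algebraic closed point of `X_K` that surjects onto `G_K`."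
[cite: MochizukiGalSect2005, Lem 3.1 p.13] -/
def Lem_3_1_i_iff_iv (C : E.CuspidalData) (P : PointData E) : Prop :=
  ∀ (Δj : ℕ → Subgroup E.geom), IsCharacteristicTower E Δj →
    ∀ σ : E.gal →ₜ* E.arith, (∀ g, E.aug (σ g) = g) →
      (∀ (c : C.Cusp) (g : E.arith), ¬ σ.toMonoidHom.range ≤ MulAut.conj g • C.Dcusp c) →
        ((∃ (x : P.Point) (g : E.arith), σ.toMonoidHom.range = MulAut.conj g • P.decomp x) ↔
          ∀ j : ℕ, ∃ (x : P.Point) (g : E.arith), P.IsAlgebraic x ∧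
            MulAut.conj g • P.decomp x ≤ sectionNeighbourhood σ Δj j ∧
              SurjectsOntoGal (MulAut.conj g • P.decomp x))

/-! ### Corollary 3.2 (Absoluteness of Decomposition Groups for Genus Zero), p. 14 -/

/-- Cor. 3.2, as a property of the group data of TWO hyperbolic curves `X_K`, `Y_L` over local
fields, each "defined over a number field" and "isogenous [§0 p. 4] to a hyperbolic curve of genus
zero" (hypotheses on the CURVES, carried by the (M)-wrapper): "every isomorphism of profinite
groups `α : Π_{X_K} ⥲ Π_{Y_L}` preserves the decomposition groups of the closed points" — `α`
carries the set of decomposition groups of closed points of `X_K` onto that of `Y_L` (cusps are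
preserved anyway, Thm. 1.3 (iii)).  Special case `X_K = Y_L` of genus zero = Thm. A p. 1.
[cite: MochizukiGalSect2005, Cor 3.2 p.14] -/
def Cor_3_2 (P : PointData E) (Q : PointData F) : Prop :=
  ∀ α : E.arith ≃ₜ* F.arith,
    (fun D : Subgroup E.arith => D.map α.toMonoidHom) '' P.decompositionGroups =
      Q.decompositionGroups

/-! ### Theorem 4.3 (Rigidity of Cuspidal Geometric Decomposition Groups), p. 17 -/

/-- The *Galois cyclotome* of [GalSect] §4 p. 17 as an OUTPUT structure (θ shape (1)): "By local
class field theory, we have a natural isomorphism `(K^×)^∧ ⥲ G_K^{ab}` … the subgroup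
`K^× ⊆ (K^×)^∧ ⥲ G_K^{ab}` may be recovered group-theoretically from the profinite group structure
of `G_K` [[AbsAnab] Prop. 1.2.1 (iv)].  Allowing «`K`» to vary among the various finite extensions
… we obtain groups `μ_{ℚ/ℤ}(K̄)`; `μ^∧_{ℚ/ℤ}(K̄) := Hom(ℚ/ℤ, μ_{ℚ/ℤ}(K̄))`" — i.e. a group
`μ(G)` attached to each profinite group together with transport along isomorphisms of profinite
groups (functorial: identities and composites).  This is an INTERFACE slot, not a second
cyclotome construction: an instance is meant to take `μ G_K := Λ(μ(K̄))`, the tree's one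
inverse-limit cyclotome `Literature.AnabelianGeometry.EtaleTheta.cyclotome`, with `map` the
class-field-theoretic transport of [AbsAnab] Prop. 1.2.1 (vi) (abc-iut-L4-t4:
`galoisMLF_iso_rootsOfUnity`, `LocalClassFieldTheoryForms`); TODO-merge with abc-iut-L4-t1's
`μ_Ẑ(G_k)` of [AbsTopIII] Cor. 1.10 (b)(c). [cite: MochizukiGalSect2005, §4 p.17] -/
structure GaloisCyclotome : Type (u + 2) where
  /-- `G ↦ μ^∧_{ℚ/ℤ}` -/
  μ : ProfiniteGrp.{u} → Type u
  /-- it is an abelian group (≅ `Ẑ(1)`) -/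
  [instCommGroup : ∀ G, CommGroup (μ G)]
  /-- transport along isomorphisms of profinite groups ("recovered group-theoretically") -/
  map : ∀ {G H : ProfiniteGrp.{u}}, (G ≃ₜ* H) → (μ G ≃* μ H)
  /-- functoriality: identity -/
  map_refl : ∀ G : ProfiniteGrp.{u}, map (ContinuousMulEquiv.refl G) = MulEquiv.refl (μ G)
  /-- functoriality: composition -/
  map_trans : ∀ {G H K : ProfiniteGrp.{u}} (e : G ≃ₜ* H) (f : H ≃ₜ* K),
    map (e.trans f) = (map e).trans (map f)

attribute [instance] GaloisCyclotome.instCommGroup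

/-- "In particular, by considering roots of local coordinates …, we obtain a natural isomorphism
`μ^∧_{ℚ/ℤ}(K̄) ⥲ I_x`" (p. 17) at a `K`-rational cusp `x` of `X_K`: the datum of this
isomorphism onto the cuspidal geometric decomposition group `I_x ⊆ Π_{X_K}`.
[cite: MochizukiGalSect2005, §4 p.17] -/
structure CuspidalSynchronization (T : GaloisCyclotome.{u}) (E : FundamentalExtension.{u})
    (C : E.CuspidalData) (x : C.Cusp) : Type u where
  /-- the natural isomorphism `μ^∧_{ℚ/ℤ}(K̄) ⥲ I_x` -/
  natIso : T.μ E.gal ≃* C.Icusp x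

/-- Thm. 4.3, as a property of the group data of two hyperbolic curves `X_K`, `Y_L` over local
fields with `K`-, resp. `L`-rational cusps `x`, `y` and their synchronizations: "In the notation of
Theorem 2.3 [`α : Π_{X_K} ⥲ Π_{Y_L}` an isomorphism of profinite groups; by Prop. 1.1 (ii) it lies
over an isomorphism `G_K ⥲ G_L`], suppose that `α` induces isomorphisms `I_x ⥲ I_y`;
`μ^∧_{ℚ/ℤ}(K̄) ⥲ μ^∧_{ℚ/ℤ}(L̄)`, where `x ∈ X̄_K(K)` (respectively, `y ∈ Ȳ_L(L)`) is a cusp.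
Then these isomorphisms are compatible with the natural isomorphisms `μ^∧_{ℚ/ℤ}(K̄) ⥲ I_x`;
`μ^∧_{ℚ/ℤ}(L̄) ⥲ I_y`" — the square `μ(G_K) → I_x → I_y` = `μ(G_K) → μ(G_L) → I_y` commutes.
[cite: MochizukiGalSect2005, Thm 4.3 p.17] -/
def Thm_4_3 (T : GaloisCyclotome.{u}) {Cx : E.CuspidalData} {Cy : F.CuspidalData}
    {x : Cx.Cusp} {y : Cy.Cusp} (sx : CuspidalSynchronization T E Cx x)
    (sy : CuspidalSynchronization T F Cy y) : Prop :=
  ∀ (α : E.arith ≃ₜ* F.arith) (αG : E.gal ≃ₜ* F.gal),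
    (∀ g : E.arith, F.aug (α g) = αG (E.aug g)) →
      (Cx.Icusp x).map α.toMonoidHom = Cy.Icusp y →
        ∀ m : T.μ E.gal, α ((sx.natIso m : Cx.Icusp x) : E.arith) =
          ((sy.natIso (T.map αG m) : Cy.Icusp y) : F.arith)

/-! ### Sanity lemmas (the predicates are not vacuous in the trivial direction) -/

/-- Under a characteristic tower, `Π[j, σ]` contains the image of the section.
[cite: MochizukiGalSect2005, §3 p.13] -/
theorem range_le_sectionNeighbourhood (σ : E.gal →ₜ* E.arith) (Δj : ℕ → Subgroup E.geom)
    (j : ℕ) : σ.toMonoidHom.range ≤ sectionNeighbourhood σ Δj j :=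
  le_sup_left

/-- `Π[j, σ]` is decreasing in `j` for a decreasing tower. [cite: MochizukiGalSect2005, §3 p.13] -/
theorem sectionNeighbourhood_antitone (σ : E.gal →ₜ* E.arith) {Δj : ℕ → Subgroup E.geom}
    (h : Antitone Δj) : Antitone (sectionNeighbourhood σ Δj) := by
  intro i j hij
  exact sup_le_sup_left (Subgroup.map_mono (h hij)) _

/-- The image of a section surjects onto `G_K` (so condition (i) of Lem. 3.1 implies that `D_x`
surjects onto `G_K`, i.e. `x` is `K`-rational, as printed: "`x ∈ X_K(K)`").
[cite: MochizukiGalSect2005, Lem 3.1 (i) p.13] -/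
theorem surjectsOntoGal_range (σ : E.gal →ₜ* E.arith) (hσ : ∀ g, E.aug (σ g) = g) :
    SurjectsOntoGal σ.toMonoidHom.range := by
  intro g _
  exact ⟨σ g, ⟨g, rfl⟩, hσ g⟩

end GalSect

end Literature.AnabelianGeometry.AbsoluteAnabelian
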